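import Summits.BirchSwinnertonDyer.BirchSwinnertonDyer.Theorems.KolyvaginDepthDoorDepthTableRowKitTwistKN
import Summits.BirchSwinnertonDyer.BirchSwinnertonDyer.Theorems.KolyvaginDepthDoorDepthTableRowsOfPrint2
import Summits.BirchSwinnertonDyer.BirchSwinnertonDyer.Theorems.KolyvaginDepthDoorDepthTableRowsOfPrint3
import Summits.BirchSwinnertonDyer.BirchSwinnertonDyer.Theorems.KolyvaginDepthDoorDepthTableRowsOfPrint4
import HarnessLib

/-!
# Route `KolyvaginDepthDoor` — rank-2 TWIST-SELMER depth-table rows `563a1`, `571b1`, `643a1`, `655a1`, `681c1`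
# ON (γ) ONLY (Kodaira–Néron certified in the kernel; crux `KolyvaginDepthSupply`,
# stmt-BirchSwinnertonDyer-21765) — part 2 of 4

Helper file (`--supports stmt-BirchSwinnertonDyer-21765 --as helper`); it closes nothing and BSD is
not proved by it.

g6/g7's twist-Selmer rows display the FIVE named McCallum / Gross leaves; `…RowsTwistSelmerPrint*` (this
seat) read them modulo (γ) + F1. This file drops F1: every curve here is on the Kodaira–Néron cell at its
`p` (`p ∤ ord_v Δ_min` at multiplicative `v`, certified from `Δ(E₀)` by the `decide`-able table of
`depthRow_twistSelmer_printKN_of_datum_of_intModel_certificate`; no additive clause at `p ≥ 5`). Inputs of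
each row `C<label>.twistSelmer_<p>_neg<D>_<ℓ>_printKN`: (γ) = `GrossLMS1991.prop37_2_frobeniusCongruence` +
the bit at ANY datum of conductor `ℓ`; conclusion `#Sel^(p)(E^{(D)}/ℚ) ≤ p` and the descent count `≤ p`.
(`944e1`, off the cell at `5`, keeps its (γ)+F1 row `…_print`.) CONDITIONAL on (γ) and the bit; per-curve;
BSD is not proved by it.
-/

set_option linter.dupNamespace false

noncomputable section

open scoped Classical NumberField

namespace Summit.BirchSwinnertonDyer.BirchSwinnertonDyer.Theorems.KolyvaginDepthDoor

open Literature.NumberTheory.EllipticCurves Literature.NumberTheory.EllipticCurves.ModularForms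
  Literature.NumberTheory.EllipticCurves.McCallum1991 WeierstrassCurve
open Summit.BirchSwinnertonDyer.BirchSwinnertonDyer.Rank2Observatory
open Summit.BirchSwinnertonDyer.BirchSwinnertonDyer.Rank1Residual

namespace C563a1

/-- **DEPTH-TABLE ROW `563a1`, `(p, d_K, ℓ) = (5, -8, 199)` — THE TWIST'S `5`-SELMER GROUP, without
Kolyvagin's structure theorem, without a point on the twist, and WITHOUT A SYSTEM.** Hypotheses
those of `C563a1.depthRow_5_neg8_199_print` ((γ) = Gross 1991 Prop. 3.7 (2) in place of the five
McCallum/Gross leaves — three are theorems after g8, Lemma 4.3 is proved on the Kodaira–Néron cell,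
certified here from `Δ(E₀) = -563` —, any imaginary quadratic `K` with `d_K = -8`, any frame, ANY
single datum `d` of conductor `199` — NO system — and its bit `d.kolyvaginClass _ 1 ≠ 0`);
conclusion: `#Sel^(5)(E^{(-8)}/ℚ) ≤ 5` (i.e. `dim_𝔽5 Sel_5(E^{(-8)}/ℚ) ≤ 1`) and the descent count
`5^{rank E^{(-8)}(ℚ)} · #E^{(-8)}(ℚ)[5] · #Ш(E^{(-8)}/ℚ)[5] ≤ 5` — Kolyvagin's second eigen-bound
`#Sel(E/K)_5^- ≤ 5` read over `ℚ` (kit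
`depthRow_twistSelmer_printKN_of_datum_of_intModel_certificate`; the compatible system through `d`
is the theorem `exists_kolyvaginHeegnerSystem_extending`); the hF-free, twist-point-free counterpart
of the hF-row's `corank Sel_{5^∞}(E^{(-8)}/ℚ) = 1`. CONDITIONAL on (γ) and the bit; per-curve; BSD
is not proved by it. [cite: Kolyvagin1991MathAnn, Thm. 2.3] [cite: McCallumLMS1991, §§2–5] [cite:
GrossLMS1991, §5 (5.1)] [cite: JetchevLauterStein2009, §3.6 (arXiv:0707.0032)] -/
theorem twistSelmer_5_neg8_199_printKN
    (h372 : GrossLMS1991.prop37_2_frobeniusCongruence)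
    (K : Type) [Field K] [NumberField K] (hK : IsImaginaryQuadratic K)
    (hD : NumberField.discr K = -8) :
    haveI := isElliptic_c563a1;
    haveI := isGloballyMinimal_c563a1;
    haveI : NeZero (((⟨1, 1, 1, -15, 16⟩ : WeierstrassCurve ℤ).map (Int.castRingHom ℚ)).conductorNorm ℤ) :=
      neZero_conductorNorm_of_isElliptic _;
    ∀ (Dt : ModularParametrizationData ((⟨1, 1, 1, -15, 16⟩ : WeierstrassCurve ℤ).map (Int.castRingHom ℚ))
        (((⟨1, 1, 1, -15, 16⟩ : WeierstrassCurve ℤ).map (Int.castRingHom ℚ)).conductorNorm ℤ)) (β : ℤ)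
      (ι : K →+* ℂ) (d : KolyvaginHeegnerData Dt β ι 199),
    d.kolyvaginClass (p := 5) (by norm_num) 1 ≠ 0 →
    Nat.card ↥(selmerGroup (((⟨1, 1, 1, -15, 16⟩ : WeierstrassCurve ℤ).map (Int.castRingHom ℚ)).quadraticTwist
        ((-8 : ℤ) : ℚ)) ((5 : ℕ) : ℤ)) ≤ 5 ∧
      5 ^ (((⟨1, 1, 1, -15, 16⟩ : WeierstrassCurve ℤ).map (Int.castRingHom ℚ)).quadraticTwist
        ((-8 : ℤ) : ℚ)).mordellWeilRank *
          Nat.card ↥(AddSubgroup.torsionBy (((⟨1, 1, 1, -15, 16⟩ : WeierstrassCurve ℤ).map (Int.castRingHom ℚ)).quadraticTwist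
        ((-8 : ℤ) : ℚ)).toAffine.Point ((5 : ℕ) : ℤ)) *
          Nat.card ↥((((⟨1, 1, 1, -15, 16⟩ : WeierstrassCurve ℤ).map (Int.castRingHom ℚ)).quadraticTwist
        ((-8 : ℤ) : ℚ)).sha ⊓
            AddSubgroup.torsionBy (((⟨1, 1, 1, -15, 16⟩ : WeierstrassCurve ℤ).map (Int.castRingHom ℚ)).quadraticTwist
        ((-8 : ℤ) : ℚ)).galH1 ((5 : ℕ) : ℤ)) ≤ 5 := by
  haveI := isElliptic_c563a1
  haveI := isGloballyMinimal_c563a1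
  haveI : NeZero (((⟨1, 1, 1, -15, 16⟩ : WeierstrassCurve ℤ).map (Int.castRingHom ℚ)).conductorNorm ℤ) :=
    neZero_conductorNorm_of_isElliptic _
  intro Dt β ι d hne
  haveI := Fact.mk (by norm_num : Nat.Prime 5)
  exact depthRow_twistSelmer_printKN_of_datum_of_intModel_certificate intModel h372 not_hasCM
    KernelCerts001.C563a1.two_le_rank 5 (by norm_num) hasSurjectiveModNGaloisRep_pow_5 K hK hD
    (by norm_num) (by norm_num) heegner_neg8 199 (by norm_num) (by norm_num) (by decide +kernel)
    (by norm_num) (by norm_num) (by norm_num) (by norm_num) (n := 220) card_199 (by norm_num)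
    (Δ₀ := -563) (by decide +kernel) (B := 11) (by decide +kernel) (by decide +kernel)
    (fun _ _ ↦ Or.inl (by norm_num)) Dt β ι d hne

end C563a1

namespace C571b1

/-- **DEPTH-TABLE ROW `571b1`, `(p, d_K, ℓ) = (5, -8, 29)` — THE TWIST'S `5`-SELMER GROUP, without
Kolyvagin's structure theorem, without a point on the twist, and WITHOUT A SYSTEM.** Hypotheses
those of `C571b1.depthRow_5_neg8_29_print` ((γ) = Gross 1991 Prop. 3.7 (2) in place of the five
McCallum/Gross leaves — three are theorems after g8, Lemma 4.3 is proved on the Kodaira–Néron cell,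
certified here from `Δ(E₀) = -571` —, any imaginary quadratic `K` with `d_K = -8`, any frame, ANY
single datum `d` of conductor `29` — NO system — and its bit `d.kolyvaginClass _ 1 ≠ 0`);
conclusion: `#Sel^(5)(E^{(-8)}/ℚ) ≤ 5` (i.e. `dim_𝔽5 Sel_5(E^{(-8)}/ℚ) ≤ 1`) and the descent count
`5^{rank E^{(-8)}(ℚ)} · #E^{(-8)}(ℚ)[5] · #Ш(E^{(-8)}/ℚ)[5] ≤ 5` — Kolyvagin's second eigen-bound
`#Sel(E/K)_5^- ≤ 5` read over `ℚ` (kit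
`depthRow_twistSelmer_printKN_of_datum_of_intModel_certificate`; the compatible system through `d`
is the theorem `exists_kolyvaginHeegnerSystem_extending`); the hF-free, twist-point-free counterpart
of the hF-row's `corank Sel_{5^∞}(E^{(-8)}/ℚ) = 1`. CONDITIONAL on (γ) and the bit; per-curve; BSD
is not proved by it. [cite: Kolyvagin1991MathAnn, Thm. 2.3] [cite: McCallumLMS1991, §§2–5] [cite:
GrossLMS1991, §5 (5.1)] [cite: JetchevLauterStein2009, §3.6 (arXiv:0707.0032)] -/
theorem twistSelmer_5_neg8_29_printKN
    (h372 : GrossLMS1991.prop37_2_frobeniusCongruence)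
    (K : Type) [Field K] [NumberField K] (hK : IsImaginaryQuadratic K)
    (hD : NumberField.discr K = -8) :
    haveI := isElliptic_c571b1;
    haveI := isGloballyMinimal_c571b1;
    haveI : NeZero (((⟨0, 1, 1, -4, 2⟩ : WeierstrassCurve ℤ).map (Int.castRingHom ℚ)).conductorNorm ℤ) :=
      neZero_conductorNorm_of_isElliptic _;
    ∀ (Dt : ModularParametrizationData ((⟨0, 1, 1, -4, 2⟩ : WeierstrassCurve ℤ).map (Int.castRingHom ℚ))
        (((⟨0, 1, 1, -4, 2⟩ : WeierstrassCurve ℤ).map (Int.castRingHom ℚ)).conductorNorm ℤ)) (β : ℤ)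
      (ι : K →+* ℂ) (d : KolyvaginHeegnerData Dt β ι 29),
    d.kolyvaginClass (p := 5) (by norm_num) 1 ≠ 0 →
    Nat.card ↥(selmerGroup (((⟨0, 1, 1, -4, 2⟩ : WeierstrassCurve ℤ).map (Int.castRingHom ℚ)).quadraticTwist
        ((-8 : ℤ) : ℚ)) ((5 : ℕ) : ℤ)) ≤ 5 ∧
      5 ^ (((⟨0, 1, 1, -4, 2⟩ : WeierstrassCurve ℤ).map (Int.castRingHom ℚ)).quadraticTwist
        ((-8 : ℤ) : ℚ)).mordellWeilRank *
          Nat.card ↥(AddSubgroup.torsionBy (((⟨0, 1, 1, -4, 2⟩ : WeierstrassCurve ℤ).map (Int.castRingHom ℚ)).quadraticTwist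
        ((-8 : ℤ) : ℚ)).toAffine.Point ((5 : ℕ) : ℤ)) *
          Nat.card ↥((((⟨0, 1, 1, -4, 2⟩ : WeierstrassCurve ℤ).map (Int.castRingHom ℚ)).quadraticTwist
        ((-8 : ℤ) : ℚ)).sha ⊓
            AddSubgroup.torsionBy (((⟨0, 1, 1, -4, 2⟩ : WeierstrassCurve ℤ).map (Int.castRingHom ℚ)).quadraticTwist
        ((-8 : ℤ) : ℚ)).galH1 ((5 : ℕ) : ℤ)) ≤ 5 := by
  haveI := isElliptic_c571b1
  haveI := isGloballyMinimal_c571b1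
  haveI : NeZero (((⟨0, 1, 1, -4, 2⟩ : WeierstrassCurve ℤ).map (Int.castRingHom ℚ)).conductorNorm ℤ) :=
    neZero_conductorNorm_of_isElliptic _
  intro Dt β ι d hne
  haveI := Fact.mk (by norm_num : Nat.Prime 5)
  exact depthRow_twistSelmer_printKN_of_datum_of_intModel_certificate intModel h372 not_hasCM
    KernelCerts001.C571b1.two_le_rank 5 (by norm_num) hasSurjectiveModNGaloisRep_pow_5 K hK hD
    (by norm_num) (by norm_num) heegner_neg8 29 (by norm_num) (by norm_num) (by decide +kernel)
    (by norm_num) (by norm_num) (by norm_num) (by norm_num) (n := 25) card_29 (by norm_num)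
    (Δ₀ := -571) (by decide +kernel) (B := 11) (by decide +kernel) (by decide +kernel)
    (fun _ _ ↦ Or.inl (by norm_num)) Dt β ι d hne

end C571b1

namespace C643a1

/-- **DEPTH-TABLE ROW `643a1`, `(p, d_K, ℓ) = (5, -8, 149)` — THE TWIST'S `5`-SELMER GROUP, without
Kolyvagin's structure theorem, without a point on the twist, and WITHOUT A SYSTEM.** Hypotheses
those of `C643a1.depthRow_5_neg8_149_print` ((γ) = Gross 1991 Prop. 3.7 (2) in place of the five
McCallum/Gross leaves — three are theorems after g8, Lemma 4.3 is proved on the Kodaira–Néron cell,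
certified here from `Δ(E₀) = -643` —, any imaginary quadratic `K` with `d_K = -8`, any frame, ANY
single datum `d` of conductor `149` — NO system — and its bit `d.kolyvaginClass _ 1 ≠ 0`);
conclusion: `#Sel^(5)(E^{(-8)}/ℚ) ≤ 5` (i.e. `dim_𝔽5 Sel_5(E^{(-8)}/ℚ) ≤ 1`) and the descent count
`5^{rank E^{(-8)}(ℚ)} · #E^{(-8)}(ℚ)[5] · #Ш(E^{(-8)}/ℚ)[5] ≤ 5` — Kolyvagin's second eigen-bound
`#Sel(E/K)_5^- ≤ 5` read over `ℚ` (kit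
`depthRow_twistSelmer_printKN_of_datum_of_intModel_certificate`; the compatible system through `d`
is the theorem `exists_kolyvaginHeegnerSystem_extending`); the hF-free, twist-point-free counterpart
of the hF-row's `corank Sel_{5^∞}(E^{(-8)}/ℚ) = 1`. CONDITIONAL on (γ) and the bit; per-curve; BSD
is not proved by it. [cite: Kolyvagin1991MathAnn, Thm. 2.3] [cite: McCallumLMS1991, §§2–5] [cite:
GrossLMS1991, §5 (5.1)] [cite: JetchevLauterStein2009, §3.6 (arXiv:0707.0032)] -/
theorem twistSelmer_5_neg8_149_printKN
    (h372 : GrossLMS1991.prop37_2_frobeniusCongruence)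
    (K : Type) [Field K] [NumberField K] (hK : IsImaginaryQuadratic K)
    (hD : NumberField.discr K = -8) :
    haveI := isElliptic_c643a1;
    haveI := isGloballyMinimal_c643a1;
    haveI : NeZero (((⟨1, 0, 0, -4, 3⟩ : WeierstrassCurve ℤ).map (Int.castRingHom ℚ)).conductorNorm ℤ) :=
      neZero_conductorNorm_of_isElliptic _;
    ∀ (Dt : ModularParametrizationData ((⟨1, 0, 0, -4, 3⟩ : WeierstrassCurve ℤ).map (Int.castRingHom ℚ))
        (((⟨1, 0, 0, -4, 3⟩ : WeierstrassCurve ℤ).map (Int.castRingHom ℚ)).conductorNorm ℤ)) (β : ℤ)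
      (ι : K →+* ℂ) (d : KolyvaginHeegnerData Dt β ι 149),
    d.kolyvaginClass (p := 5) (by norm_num) 1 ≠ 0 →
    Nat.card ↥(selmerGroup (((⟨1, 0, 0, -4, 3⟩ : WeierstrassCurve ℤ).map (Int.castRingHom ℚ)).quadraticTwist
        ((-8 : ℤ) : ℚ)) ((5 : ℕ) : ℤ)) ≤ 5 ∧
      5 ^ (((⟨1, 0, 0, -4, 3⟩ : WeierstrassCurve ℤ).map (Int.castRingHom ℚ)).quadraticTwist
        ((-8 : ℤ) : ℚ)).mordellWeilRank *
          Nat.card ↥(AddSubgroup.torsionBy (((⟨1, 0, 0, -4, 3⟩ : WeierstrassCurve ℤ).map (Int.castRingHom ℚ)).quadraticTwist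
        ((-8 : ℤ) : ℚ)).toAffine.Point ((5 : ℕ) : ℤ)) *
          Nat.card ↥((((⟨1, 0, 0, -4, 3⟩ : WeierstrassCurve ℤ).map (Int.castRingHom ℚ)).quadraticTwist
        ((-8 : ℤ) : ℚ)).sha ⊓
            AddSubgroup.torsionBy (((⟨1, 0, 0, -4, 3⟩ : WeierstrassCurve ℤ).map (Int.castRingHom ℚ)).quadraticTwist
        ((-8 : ℤ) : ℚ)).galH1 ((5 : ℕ) : ℤ)) ≤ 5 := by
  haveI := isElliptic_c643a1
  haveI := isGloballyMinimal_c643a1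
  haveI : NeZero (((⟨1, 0, 0, -4, 3⟩ : WeierstrassCurve ℤ).map (Int.castRingHom ℚ)).conductorNorm ℤ) :=
    neZero_conductorNorm_of_isElliptic _
  intro Dt β ι d hne
  haveI := Fact.mk (by norm_num : Nat.Prime 5)
  exact depthRow_twistSelmer_printKN_of_datum_of_intModel_certificate intModel h372 not_hasCM
    KernelCerts001.C643a1.two_le_rank 5 (by norm_num) hasSurjectiveModNGaloisRep_pow_5 K hK hD
    (by norm_num) (by norm_num) heegner_neg8 149 (by norm_num) (by norm_num) (by decide +kernel)
    (by norm_num) (by norm_num) (by norm_num) (by norm_num) (n := 135) card_149 (by norm_num)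
    (Δ₀ := -643) (by decide +kernel) (B := 11) (by decide +kernel) (by decide +kernel)
    (fun _ _ ↦ Or.inl (by norm_num)) Dt β ι d hne

end C643a1

namespace C655a1

/-- **DEPTH-TABLE ROW `655a1`, `(p, d_K, ℓ) = (7, -51, 83)` — THE TWIST'S `7`-SELMER GROUP, without
Kolyvagin's structure theorem, without a point on the twist, and WITHOUT A SYSTEM.** Hypotheses
those of `C655a1.depthRow_7_neg51_83_print` ((γ) = Gross 1991 Prop. 3.7 (2) in place of the five
McCallum/Gross leaves — three are theorems after g8, Lemma 4.3 is proved on the Kodaira–Néron cell,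
certified here from `Δ(E₀) = -3275` —, any imaginary quadratic `K` with `d_K = -51`, any frame, ANY
single datum `d` of conductor `83` — NO system — and its bit `d.kolyvaginClass _ 1 ≠ 0`);
conclusion: `#Sel^(7)(E^{(-51)}/ℚ) ≤ 7` (i.e. `dim_𝔽7 Sel_7(E^{(-51)}/ℚ) ≤ 1`) and the descent count
`7^{rank E^{(-51)}(ℚ)} · #E^{(-51)}(ℚ)[7] · #Ш(E^{(-51)}/ℚ)[7] ≤ 7` — Kolyvagin's second eigen-bound
`#Sel(E/K)_7^- ≤ 7` read over `ℚ` (kit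
`depthRow_twistSelmer_printKN_of_datum_of_intModel_certificate`; the compatible system through `d`
is the theorem `exists_kolyvaginHeegnerSystem_extending`); the hF-free, twist-point-free counterpart
of the hF-row's `corank Sel_{7^∞}(E^{(-51)}/ℚ) = 1`. CONDITIONAL on (γ) and the bit; per-curve; BSD
is not proved by it. [cite: Kolyvagin1991MathAnn, Thm. 2.3] [cite: McCallumLMS1991, §§2–5] [cite:
GrossLMS1991, §5 (5.1)] [cite: JetchevLauterStein2009, §3.6 (arXiv:0707.0032)] -/
theorem twistSelmer_7_neg51_83_printKN
    (h372 : GrossLMS1991.prop37_2_frobeniusCongruence)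
    (K : Type) [Field K] [NumberField K] (hK : IsImaginaryQuadratic K)
    (hD : NumberField.discr K = -51) :
    haveI := isElliptic_c655a1;
    haveI := isGloballyMinimal_c655a1;
    haveI : NeZero (((⟨0, 0, 1, -13, 18⟩ : WeierstrassCurve ℤ).map (Int.castRingHom ℚ)).conductorNorm ℤ) :=
      neZero_conductorNorm_of_isElliptic _;
    ∀ (Dt : ModularParametrizationData ((⟨0, 0, 1, -13, 18⟩ : WeierstrassCurve ℤ).map (Int.castRingHom ℚ))
        (((⟨0, 0, 1, -13, 18⟩ : WeierstrassCurve ℤ).map (Int.castRingHom ℚ)).conductorNorm ℤ)) (β : ℤ)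
      (ι : K →+* ℂ) (d : KolyvaginHeegnerData Dt β ι 83),
    d.kolyvaginClass (p := 7) (by norm_num) 1 ≠ 0 →
    Nat.card ↥(selmerGroup (((⟨0, 0, 1, -13, 18⟩ : WeierstrassCurve ℤ).map (Int.castRingHom ℚ)).quadraticTwist
        ((-51 : ℤ) : ℚ)) ((7 : ℕ) : ℤ)) ≤ 7 ∧
      7 ^ (((⟨0, 0, 1, -13, 18⟩ : WeierstrassCurve ℤ).map (Int.castRingHom ℚ)).quadraticTwist
        ((-51 : ℤ) : ℚ)).mordellWeilRank *
          Nat.card ↥(AddSubgroup.torsionBy (((⟨0, 0, 1, -13, 18⟩ : WeierstrassCurve ℤ).map (Int.castRingHom ℚ)).quadraticTwist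
        ((-51 : ℤ) : ℚ)).toAffine.Point ((7 : ℕ) : ℤ)) *
          Nat.card ↥((((⟨0, 0, 1, -13, 18⟩ : WeierstrassCurve ℤ).map (Int.castRingHom ℚ)).quadraticTwist
        ((-51 : ℤ) : ℚ)).sha ⊓
            AddSubgroup.torsionBy (((⟨0, 0, 1, -13, 18⟩ : WeierstrassCurve ℤ).map (Int.castRingHom ℚ)).quadraticTwist
        ((-51 : ℤ) : ℚ)).galH1 ((7 : ℕ) : ℤ)) ≤ 7 := by
  haveI := isElliptic_c655a1
  haveI := isGloballyMinimal_c655a1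
  haveI : NeZero (((⟨0, 0, 1, -13, 18⟩ : WeierstrassCurve ℤ).map (Int.castRingHom ℚ)).conductorNorm ℤ) :=
    neZero_conductorNorm_of_isElliptic _
  intro Dt β ι d hne
  haveI := Fact.mk (by norm_num : Nat.Prime 7)
  exact depthRow_twistSelmer_printKN_of_datum_of_intModel_certificate intModel h372 not_hasCM
    KernelCerts001.C655a1.two_le_rank 7 (by norm_num) hasSurjectiveModNGaloisRep_pow_7 K hK hD
    (by norm_num) (by norm_num) heegner_neg51 83 (by norm_num) (by norm_num) (by decide +kernel)
    (by norm_num) (by norm_num) (by norm_num) (by norm_num) (n := 70) card_83 (by norm_num)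
    (Δ₀ := -3275) (by decide +kernel) (B := 11) (by decide +kernel) (by decide +kernel)
    (fun _ _ ↦ Or.inl (by norm_num)) Dt β ι d hne

end C655a1

namespace C681c1

/-- **DEPTH-TABLE ROW `681c1`, `(p, d_K, ℓ) = (5, -83, 19)` — THE TWIST'S `5`-SELMER GROUP, without
Kolyvagin's structure theorem, without a point on the twist, and WITHOUT A SYSTEM.** Hypotheses
those of `C681c1.depthRow_5_neg83_19_print` ((γ) = Gross 1991 Prop. 3.7 (2) in place of the five
McCallum/Gross leaves — three are theorems after g8, Lemma 4.3 is proved on the Kodaira–Néron cell,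
certified here from `Δ(E₀) = -2043` —, any imaginary quadratic `K` with `d_K = -83`, any frame, ANY
single datum `d` of conductor `19` — NO system — and its bit `d.kolyvaginClass _ 1 ≠ 0`);
conclusion: `#Sel^(5)(E^{(-83)}/ℚ) ≤ 5` (i.e. `dim_𝔽5 Sel_5(E^{(-83)}/ℚ) ≤ 1`) and the descent count
`5^{rank E^{(-83)}(ℚ)} · #E^{(-83)}(ℚ)[5] · #Ш(E^{(-83)}/ℚ)[5] ≤ 5` — Kolyvagin's second eigen-bound
`#Sel(E/K)_5^- ≤ 5` read over `ℚ` (kit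
`depthRow_twistSelmer_printKN_of_datum_of_intModel_certificate`; the compatible system through `d`
is the theorem `exists_kolyvaginHeegnerSystem_extending`); the hF-free, twist-point-free counterpart
of the hF-row's `corank Sel_{5^∞}(E^{(-83)}/ℚ) = 1`. CONDITIONAL on (γ) and the bit; per-curve; BSD
is not proved by it. [cite: Kolyvagin1991MathAnn, Thm. 2.3] [cite: McCallumLMS1991, §§2–5] [cite:
GrossLMS1991, §5 (5.1)] [cite: JetchevLauterStein2009, §3.6 (arXiv:0707.0032)] -/
theorem twistSelmer_5_neg83_19_printKN
    (h372 : GrossLMS1991.prop37_2_frobeniusCongruence)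
    (K : Type) [Field K] [NumberField K] (hK : IsImaginaryQuadratic K)
    (hD : NumberField.discr K = -83) :
    haveI := isElliptic_c681c1;
    haveI := isGloballyMinimal_c681c1;
    haveI : NeZero (((⟨0, -1, 1, 0, 2⟩ : WeierstrassCurve ℤ).map (Int.castRingHom ℚ)).conductorNorm ℤ) :=
      neZero_conductorNorm_of_isElliptic _;
    ∀ (Dt : ModularParametrizationData ((⟨0, -1, 1, 0, 2⟩ : WeierstrassCurve ℤ).map (Int.castRingHom ℚ))
        (((⟨0, -1, 1, 0, 2⟩ : WeierstrassCurve ℤ).map (Int.castRingHom ℚ)).conductorNorm ℤ)) (β : ℤ)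
      (ι : K →+* ℂ) (d : KolyvaginHeegnerData Dt β ι 19),
    d.kolyvaginClass (p := 5) (by norm_num) 1 ≠ 0 →
    Nat.card ↥(selmerGroup (((⟨0, -1, 1, 0, 2⟩ : WeierstrassCurve ℤ).map (Int.castRingHom ℚ)).quadraticTwist
        ((-83 : ℤ) : ℚ)) ((5 : ℕ) : ℤ)) ≤ 5 ∧
      5 ^ (((⟨0, -1, 1, 0, 2⟩ : WeierstrassCurve ℤ).map (Int.castRingHom ℚ)).quadraticTwist
        ((-83 : ℤ) : ℚ)).mordellWeilRank *
          Nat.card ↥(AddSubgroup.torsionBy (((⟨0, -1, 1, 0, 2⟩ : WeierstrassCurve ℤ).map (Int.castRingHom ℚ)).quadraticTwist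
        ((-83 : ℤ) : ℚ)).toAffine.Point ((5 : ℕ) : ℤ)) *
          Nat.card ↥((((⟨0, -1, 1, 0, 2⟩ : WeierstrassCurve ℤ).map (Int.castRingHom ℚ)).quadraticTwist
        ((-83 : ℤ) : ℚ)).sha ⊓
            AddSubgroup.torsionBy (((⟨0, -1, 1, 0, 2⟩ : WeierstrassCurve ℤ).map (Int.castRingHom ℚ)).quadraticTwist
        ((-83 : ℤ) : ℚ)).galH1 ((5 : ℕ) : ℤ)) ≤ 5 := by
  haveI := isElliptic_c681c1
  haveI := isGloballyMinimal_c681c1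
  haveI : NeZero (((⟨0, -1, 1, 0, 2⟩ : WeierstrassCurve ℤ).map (Int.castRingHom ℚ)).conductorNorm ℤ) :=
    neZero_conductorNorm_of_isElliptic _
  intro Dt β ι d hne
  haveI := Fact.mk (by norm_num : Nat.Prime 5)
  exact depthRow_twistSelmer_printKN_of_datum_of_intModel_certificate intModel h372 not_hasCM
    KernelCerts002.C681c1.two_le_rank 5 (by norm_num) hasSurjectiveModNGaloisRep_pow_5 K hK hD
    (by norm_num) (by norm_num) heegner_neg83 19 (by norm_num) (by norm_num) (by decide +kernel)
    (by norm_num) (by norm_num) (by norm_num) (by norm_num) (n := 25) card_19 (by norm_num)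
    (Δ₀ := -2043) (by decide +kernel) (B := 11) (by decide +kernel) (by decide +kernel)
    (fun _ _ ↦ Or.inl (by norm_num)) Dt β ι d hne

end C681c1

end Summit.BirchSwinnertonDyer.BirchSwinnertonDyer.Theorems.KolyvaginDepthDoor

end
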